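import Summits.NavierStokesRegularity.NavierStokesRegularity.Theorems.ExtremiserTransienceTwoThirdsBallCalculus
import Summits.NavierStokesRegularity.NavierStokesRegularity.Theorems.ExtremiserTransienceTwoThirdsNormalisedDefs
import Summits.NavierStokesRegularity.NavierStokesRegularity.Theorems.ExtremiserTransienceLocalMaximiserExtraction
import HarnessLib

/-!
# Route `ExtremiserTransience`, crux `NearExtremalTransiencePerFlow` (stmt-NavierStokesRegularity-26567),
# LINE g10-1 «two_thirds» (ns-idea-10), stub S1a′ `TypicalSelectionLarge` — BRICK 4e: NORMALISATION to height `1`, Taylor length `1`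

`--supports stmt-NavierStokesRegularity-26567` (helper; prover seat ns-net-p2 g12).  `TypicalSelectionLarge` (texts of record p725367) is
scale-covariant; this file proves it from its NORMALISED form — the same statement for fields `w` with `‖w‖ ≤ 1` and `lam w = 1`, linear growth
`∫_{B(y,r)} |w|² ≤ A_E r`, good balls in cell units `IsGoodBall` — by the affine zoom `w = azoom M⁻¹ λ 0 v = x ↦ M⁻¹ v(λx)` and the landed zoom
calculus (`enstrophy_zoom` / `palinstrophy_zoom` / `stretching_zoom`, `norm_iteratedFDeriv_azoom_le`, `locGain_azoom`, `isGoodBallAt_iff_isGoodBall_azoom`,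
`setIntegral_ball_comp_affine`).  So the analytic heart of S1a′ (brick 2, the localised sharp inequality) may be written at `M = λ = 1`.

* `typicalSelectionLarge_of_normalised : (normalised form) → TypicalSelectionLarge`.
HONEST FRAMING: bookkeeping; nothing about Navier–Stokes is proved; no summit is proved by a line. [folklore]
-/

noncomputable section

open scoped Topology InnerProductSpace RealInnerProductSpace ENNReal ContDiff
open MeasureTheory Filter Set Metric Function
open Literature.Analysis Literature.Analysis.FluidPDE
open Summit.NavierStokesRegularity.NavierStokesRegularity.Theorems.DepletionLadder.KStar.HalfSpace
open Summit.NavierStokesRegularity.NavierStokesRegularity.Theorems.DepletionLadder.KStar.BangBang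
open Summit.NavierStokesRegularity.NavierStokesRegularity.Theorems.NearExtremalTransiencePerFlow.LocalMaximiser
open Summit.NavierStokesRegularity.NavierStokesRegularity.Theorems.ExtremiserTransience

namespace Summit.NavierStokesRegularity.NavierStokesRegularity.Theorems.NearExtremalTransiencePerFlow.TwoThirds

-- the problem directory repeats the summit name (`NavierStokesRegularity/NavierStokesRegularity`)
set_option linter.dupNamespace false
set_option linter.style.longLine false

/-- **Normalisation**: the normalised form implies `TypicalSelectionLarge` (zoom `w = x ↦ M⁻¹ v(λ x)`, `λ = lam v`). [folklore] -/
theorem typicalSelectionLarge_of_normalised (hN : TypicalSelectionNormalised) : TypicalSelectionLarge := by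
  intro A hA A_E hAE
  obtain ⟨θ₀, K, hθ₀, hK, i₁, H⟩ := hN A hA A_E hAE
  refine ⟨θ₀, K, hθ₀, hK, i₁, fun R η m hR hη => ?_⟩
  obtain ⟨ε₀, hε₀, H'⟩ := H R η m hR hη
  refine ⟨ε₀, hε₀, ?_⟩
  intro v M B ε hadm hreg hZ hW hε0 hε hext hgrowth
  obtain ⟨hv, hdiv, hvM, hvB, h0, h1, h2⟩ := id hadm
  -- positivity of `M` and `λ`
  set L : ℝ := lam v with hLdef
  have hl : 0 < L := Real.sqrt_pos.2 (div_pos hZ hW)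
  have hM : 0 < M := by
    by_contra hM'
    have hM0 : M ≤ 0 := not_lt.1 hM'
    have hv0 : v = 0 := by
      funext x; exact norm_le_zero_iff.1 ((hvM x).trans hM0)
    have : Zen v = 0 := by unfold Zen; simp [hv0]
    exact hZ.ne' this
  have hMi : 0 < M⁻¹ := inv_pos.2 hM
  -- the normalised field
  set w : E3 → E3 := azoom M⁻¹ L 0 v with hwdef
  have hw_fun : w = fun y => M⁻¹ • v (L • y) := by
    funext y; rw [hwdef, azoom_apply, zero_add]
  -- enstrophy / palinstrophy / stretching of `w`
  have hZw : Zen w = M⁻¹ ^ 2 * L⁻¹ * Zen v := by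
    unfold Zen; rw [hw_fun]; exact enstrophy_zoom v M⁻¹ hl
  have hWw : Wpa w = M⁻¹ ^ 2 * L * Wpa v := by
    unfold Wpa; rw [hw_fun]; exact palinstrophy_zoom v M⁻¹ hl
  have hJw : Jst w = M⁻¹ ^ 3 * Jst v := by
    unfold Jst; rw [hw_fun]; exact stretching_zoom v M⁻¹ hl
  have hZwpos : 0 < Zen w := by rw [hZw]; positivity
  have hWwpos : 0 < Wpa w := by rw [hWw]; positivity
  have hL2 : L ^ 2 = Zen v / Wpa v := by rw [hLdef]; unfold lam; exact Real.sq_sqrt (div_pos hZ hW).le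
  have hlamw : lam w = 1 := by
    unfold lam
    rw [hZw, hWw]
    have e : M⁻¹ ^ 2 * L⁻¹ * Zen v / (M⁻¹ ^ 2 * L * Wpa v) = (Zen v / Wpa v) / L ^ 2 := by
      field_simp
    rw [e, ← hL2, div_self (pow_pos hl 2).ne', Real.sqrt_one]
  -- admissibility at height `1`
  have hwadm : IsAdm w 1 (M⁻¹ * L * B) := by
    refine ⟨contDiff_azoom hv _ _ _, isDivFree_azoom hv hdiv _ _ _, fun x => ?_, fun x => ?_, ?_, ?_, ?_⟩
    · rw [hwdef, azoom_apply, norm_smul, Real.norm_eq_abs, abs_of_pos hMi]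
      calc M⁻¹ * ‖v (0 + L • x)‖ ≤ M⁻¹ * M := mul_le_mul_of_nonneg_left (hvM _) hMi.le
        _ = 1 := inv_mul_cancel₀ hM.ne'
    · rw [hwdef, fderiv_azoom, norm_smul, Real.norm_eq_abs, abs_of_pos (mul_pos hMi hl)]
      exact mul_le_mul_of_nonneg_left (hvB _) (mul_pos hMi hl).le
    · rw [hw_fun]; exact lintegral_iteratedFDeriv_zoom_lt_top hv M⁻¹ hl 0 h0
    · rw [hw_fun]; exact lintegral_iteratedFDeriv_zoom_lt_top hv M⁻¹ hl 1 h1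
    · rw [hw_fun]; exact lintegral_iteratedFDeriv_zoom_lt_top hv M⁻¹ hl 2 h2
  -- regularity at height `1` (Taylor length `1`)
  have hwreg : IsReg A w 1 := by
    intro j x
    rw [hlamw, inv_one, one_pow, mul_one, mul_one]
    have h := norm_iteratedFDeriv_azoom_le hv M⁻¹ L 0 j x
    rw [abs_of_pos hMi, abs_of_pos hl] at h
    refine h.trans ?_
    have hr := hreg j (0 + L • x)
    calc M⁻¹ * L ^ j * ‖iteratedFDeriv ℝ j v (0 + L • x)‖ ≤ M⁻¹ * L ^ j * (A j * M * L⁻¹ ^ j) :=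
          mul_le_mul_of_nonneg_left hr (by positivity)
      _ = (M⁻¹ * M) * (L ^ j * L⁻¹ ^ j) * A j := by ring
      _ = A j := by rw [inv_mul_cancel₀ hM.ne', inv_pow, mul_inv_cancel₀ (pow_ne_zero j hl.ne'), one_mul, one_mul]
  -- near-extremality at height `1`
  have hextw : (kStar - ε) * Real.sqrt (Zen w) * Real.sqrt (Wpa w) ≤ Jst w := by
    have hsq : Real.sqrt (Zen w) * Real.sqrt (Wpa w) = M⁻¹ ^ 2 * (Real.sqrt (Zen v) * Real.sqrt (Wpa v)) := by
      unfold Zen Wpa; rw [hw_fun]; exact sqrt_enstrophy_mul_sqrt_palinstrophy_zoom v M⁻¹ hl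
    rw [mul_assoc, hsq, hJw]
    have h := mul_le_mul_of_nonneg_left hext (pow_pos hMi 3).le
    have e1 : (kStar - ε) * (M⁻¹ ^ 2 * (Real.sqrt (Zen v) * Real.sqrt (Wpa v))) =
        M⁻¹ ^ 3 * ((kStar - ε) * M * Real.sqrt (Zen v) * Real.sqrt (Wpa v)) := by field_simp
    rw [e1]; exact h
  -- linear growth in cell units
  have hgrowthw : ∀ (y : E3) (r : ℝ), 0 < r → ∫ x in Metric.ball y r, ‖w x‖ ^ 2 ≤ A_E * r := by
    intro y r hr
    have e : (fun x => ‖w x‖ ^ 2) = fun x => M⁻¹ ^ 2 * (fun z => ‖v z‖ ^ 2) ((0 : E3) + L • x) := by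
      funext x; rw [hwdef, azoom_apply, norm_smul, Real.norm_eq_abs, abs_of_pos hMi, mul_pow]
    rw [e, integral_const_mul, setIntegral_ball_comp_affine hl 0 y r (fun z => ‖v z‖ ^ 2)]
    have hg := hgrowth ((0 : E3) + L • y) r hr
    rw [mul_comm r L] at hg
    calc M⁻¹ ^ 2 * ((L ^ 3)⁻¹ * ∫ z in Metric.ball ((0 : E3) + L • y) (L * r), ‖v z‖ ^ 2)
        ≤ M⁻¹ ^ 2 * ((L ^ 3)⁻¹ * (A_E * M ^ 2 * L ^ 3 * r)) := by gcongr
      _ = A_E * r := by field_simp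
  -- the normalised conclusion
  obtain ⟨x₀', hthick', hgood', hballs'⟩ := H' w (M⁻¹ * L * B) ε hwadm hwreg hZwpos hWwpos hlamw hε0 hε hextw hgrowthw
  refine ⟨(0 : E3) + L • x₀', ?_, ?_, ?_⟩
  · -- thickness transported back
    have hc : curl w x₀' = (M⁻¹ * L) • curl v (0 + L • x₀') := by rw [hwdef, curl_azoom]
    rw [hc, norm_smul, Real.norm_eq_abs, abs_of_pos (mul_pos hMi hl)] at hthick'
    show θ₀ * M * L⁻¹ ≤ _
    calc θ₀ * M * L⁻¹ = (M⁻¹ * L)⁻¹ * θ₀ := by field_simp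
      _ ≤ (M⁻¹ * L)⁻¹ * (M⁻¹ * L * ‖curl v (0 + L • x₀')‖) := mul_le_mul_of_nonneg_left hthick' (by positivity)
      _ = ‖curl v (0 + L • x₀')‖ := by field_simp
  · -- goodness transported back: a physical test `φ` becomes the normalised test `azoom M⁻¹ λ 0 φ`
    intro φ hφ hsupp
    obtain ⟨hφs, hφc, hφdiv, hφle⟩ := hφ
    set ψ : E3 → E3 := azoom M⁻¹ L 0 φ with hψdef
    have hψ : IsTestAt w 1 ψ := by
      refine ⟨contDiff_azoom hφs _ _ _, hasCompactSupport_azoom hl.ne' hφc _ _, isDivFree_azoom hφs hφdiv _ _ _, fun y hy => ?_⟩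
      have hy' : (0 : E3) + L • y ∈ tsupport φ := mem_tsupport_of_mem_tsupport_azoom hy
      have h := hφle _ hy'
      rw [hwdef, hψdef, azoom_apply, azoom_apply, ← smul_add, norm_smul, Real.norm_eq_abs, abs_of_pos hMi]
      calc M⁻¹ * ‖v (0 + L • y) + φ (0 + L • y)‖ ≤ M⁻¹ * M := mul_le_mul_of_nonneg_left h hMi.le
        _ = 1 := inv_mul_cancel₀ hM.ne'
    have hψsupp : tsupport ψ ⊆ Metric.ball x₀' R := by
      intro y hy
      have hy' : (0 : E3) + L • y ∈ tsupport φ := mem_tsupport_of_mem_tsupport_azoom hy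
      have hmem := hsupp hy'
      rw [mul_comm R L] at hmem
      exact (mem_ball_affine_iff hl 0 x₀' y R).1 hmem
    have hgain := hgood' ψ hψ hψsupp
    have hz : locGain kStar 1 w ψ = M⁻¹ ^ 3 * locGain (kStar * M) L v φ := by
      rw [hwdef, hψdef, locGain_azoom (inv_ne_zero hM.ne') hl, div_inv_eq_mul, one_mul]
    rw [hz] at hgain
    have h := mul_le_mul_of_nonneg_left hgain (pow_pos hM 3).le
    have e : M ^ 3 * (M⁻¹ ^ 3 * locGain (kStar * M) L v φ) = locGain (kStar * M) L v φ := by field_simp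
    rw [e] at h
    show locGain (kStar * M) L v φ ≤ η * M ^ 3
    linarith
  · -- good balls transported back
    intro i hi₁ hi
    obtain ⟨c', r, hdist, h4, h24, hgb⟩ := hballs' i hi₁ hi
    refine ⟨(0 : E3) + L • c', r, ?_, h4, h24, ?_⟩
    · show dist ((0 : E3) + L • c') ((0 : E3) + L • x₀') ≤ r * L / 2
      rw [dist_eq_norm, add_sub_add_left_eq_sub, ← smul_sub, norm_smul, Real.norm_eq_abs, abs_of_pos hl,
        ← dist_eq_norm]
      calc L * dist c' x₀' ≤ L * (r / 2) := mul_le_mul_of_nonneg_left hdist hl.le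
        _ = r * L / 2 := by ring
    · exact (isGoodBallAt_iff_isGoodBall_azoom hM hl c' r _).2 hgb

end Summit.NavierStokesRegularity.NavierStokesRegularity.Theorems.NearExtremalTransiencePerFlow.TwoThirds

end
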